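import Literature.Geometry.Lorentzian.KerrIngoingCoordConnection
import HarnessLib

/-!
# The Kerr metric in ingoing Kerr coordinates `(t*, r, μ, φ)`, VI: the Christoffel symbols, II

Infrastructure (all results proved), continuing `KerrIngoingCoordConnection.lean`: the closed forms
`Γ(∂_i, ∂_j)`, `1 ≤ i ≤ j ≤ 3`, of the Christoffel symbols of the Kerr components
`Kerr.Ingoing.bilin M a` (O'Neill 1983, Ch. 3, Prop. 3.13) on the regular set `{Σ ≠ 0, μ² ≠ 1}`. The
closed forms were generated by computer algebra (exact rational arithmetic over `ℚ(r, μ, M, a)`) and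
are checked here by Lean; nothing is taken on trust. Exponents are written `^ (n : ℕ)` in the
generated expressions: fixing the exponent type up front keeps their elaboration fast.

## References

* R. P. Kerr, Phys. Rev. Lett. 11 (1963) 237–238; R. P. Kerr, A. Schild, *A new class of vacuum
  solutions of the Einstein field equations* (1965), §3.
* B. O'Neill, *Semi-Riemannian geometry* (1983), Ch. 3, Prop. 3.13, Lemma 3.38, Prop. 3.36.
* M. Visser, *The Kerr spacetime: a brief introduction*, arXiv:0706.0622, (E:K1)–(E:K2).
* R. C. Henry, *Kretschmann scalar for a Kerr–Newman black hole*, Astrophys. J. 535 (2000) 350.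
-/

noncomputable section

set_option maxSynthPendingDepth 3

open Set Function Module
open scoped ContDiff Topology
open Literature.Geometry.Lorentzian.MetricCoord

namespace Literature.Geometry.Lorentzian

namespace Kerr

namespace Ingoing

variable (M a : ℝ) {u : E4}

/-! ### The Christoffel symbols in closed form (continued) -/

/-- **`Γ(∂_1, ∂_1)`** of the Kerr components in ingoing Kerr coordinates (closed form, a vector of
`E4`; O'Neill 1983, Ch. 3, Prop. 3.13). [cite: KerrSchild1965, §3] -/
theorem chrAt_bv_11 (hu : u ∈ regularSet a) :
    chrAt (bilin M a) u (E4.basisVector 1) (E4.basisVector 1) =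
      !₂[(-(2 * u 2 ^ (4 : ℕ) * M * a ^ (4 : ℕ)) -
          2 * u 1 * u 2 ^ (2 : ℕ) * M ^ (2 : ℕ) * a ^ (2 : ℕ) + 2 * u 1 ^ (3 : ℕ) * M ^ (2 : ℕ) +
          2 * u 1 ^ (4 : ℕ) * M) / sigma a u ^ (3 : ℕ),
        (2 * u 2 ^ (4 : ℕ) * M * a ^ (4 : ℕ) - u 2 ^ (2 : ℕ) * M * a ^ (4 : ℕ) +
          2 * u 1 * u 2 ^ (2 : ℕ) * M ^ (2 : ℕ) * a ^ (2 : ℕ) -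
          u 1 ^ (2 : ℕ) * u 2 ^ (2 : ℕ) * M * a ^ (2 : ℕ) + u 1 ^ (2 : ℕ) * M * a ^ (2 : ℕ) -
          2 * u 1 ^ (3 : ℕ) * M ^ (2 : ℕ) - u 1 ^ (4 : ℕ) * M) / sigma a u ^ (3 : ℕ),
        (-(2 * u 1 * u 2 ^ (3 : ℕ) * M * a ^ (2 : ℕ)) +
          2 * u 1 * u 2 * M * a ^ (2 : ℕ)) / sigma a u ^ (3 : ℕ),
        (-(u 2 ^ (2 : ℕ) * M * a ^ (3 : ℕ)) + u 1 ^ (2 : ℕ) * M * a) / sigma a u ^ (3 : ℕ)] := by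
  refine chrAt_eq_of_forall M a hu fun w ↦ ?_
  have hS := hu.1
  have hP := hu.2
  rw [map_smul, _root_.smul_apply, koszulCLM_eq_koszulForm, koszulForm_bilin M a hu, bilin_apply]
  simp only [bilinR_apply, bilinM_apply, bv_apply, Fin.isValue, Fin.reduceEq, if_true, if_false,
    Matrix.cons_val_zero, Matrix.cons_val_one, Matrix.cons_val, smul_eq_mul, mul_one, one_mul,
    mul_zero, zero_mul, add_zero, zero_add]
  simp only [h00, h03, c13, c22, c33, h00r, h00m, h03r, scalarH, scalarHr, scalarHm]
  field_simp
  simp only [sigma, sinSq]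
  ring

/-- **`Γ(∂_1, ∂_2)`** of the Kerr components in ingoing Kerr coordinates (closed form, a vector of
`E4`; O'Neill 1983, Ch. 3, Prop. 3.13). [cite: KerrSchild1965, §3] -/
theorem chrAt_bv_12 (hu : u ∈ regularSet a) :
    chrAt (bilin M a) u (E4.basisVector 1) (E4.basisVector 2) =
      !₂[(2 * u 1 * u 2 * M * a ^ (2 : ℕ)) / sigma a u ^ (2 : ℕ),
        (u 2 * a ^ (2 : ℕ)) / sigma a u,
        (u 1) / sigma a u,
        (u 2 ^ (3 : ℕ) * a ^ (3 : ℕ) + 2 * u 1 * u 2 * M * a +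
          u 1 ^ (2 : ℕ) * u 2 * a) / (sigma a u ^ (2 : ℕ) * sinSq u)] := by
  refine chrAt_eq_of_forall M a hu fun w ↦ ?_
  have hS := hu.1
  have hP := hu.2
  rw [map_smul, _root_.smul_apply, koszulCLM_eq_koszulForm, koszulForm_bilin M a hu, bilin_apply]
  simp only [bilinR_apply, bilinM_apply, bv_apply, Fin.isValue, Fin.reduceEq, if_true, if_false,
    Matrix.cons_val_zero, Matrix.cons_val_one, Matrix.cons_val, smul_eq_mul, mul_one, one_mul,
    mul_zero, zero_mul, add_zero, zero_add, sub_zero]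
  simp only [h00, h03, c13, c22, c33, c22r, h00m, h03m, scalarH, scalarHm]
  field_simp
  simp only [sigma, sinSq]
  ring

/-- **`Γ(∂_1, ∂_3)`** of the Kerr components in ingoing Kerr coordinates (closed form, a vector of
`E4`; O'Neill 1983, Ch. 3, Prop. 3.13). [cite: KerrSchild1965, §3] -/
theorem chrAt_bv_13 (hu : u ∈ regularSet a) :
    chrAt (bilin M a) u (E4.basisVector 1) (E4.basisVector 3) =
      !₂[(-(u 2 ^ (6 : ℕ) * M * a ^ (5 : ℕ)) + u 2 ^ (4 : ℕ) * M * a ^ (5 : ℕ) -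
          2 * u 1 * u 2 ^ (4 : ℕ) * M ^ (2 : ℕ) * a ^ (3 : ℕ) +
          2 * u 1 * u 2 ^ (2 : ℕ) * M ^ (2 : ℕ) * a ^ (3 : ℕ) +
          2 * u 1 ^ (3 : ℕ) * u 2 ^ (2 : ℕ) * M ^ (2 : ℕ) * a +
          u 1 ^ (4 : ℕ) * u 2 ^ (2 : ℕ) * M * a - 2 * u 1 ^ (3 : ℕ) * M ^ (2 : ℕ) * a -
          u 1 ^ (4 : ℕ) * M * a) / sigma a u ^ (3 : ℕ),
        (u 2 ^ (6 : ℕ) * M * a ^ (5 : ℕ) - u 1 * u 2 ^ (6 : ℕ) * a ^ (5 : ℕ) -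
          2 * u 2 ^ (4 : ℕ) * M * a ^ (5 : ℕ) + u 1 * u 2 ^ (4 : ℕ) * a ^ (5 : ℕ) +
          2 * u 1 * u 2 ^ (4 : ℕ) * M ^ (2 : ℕ) * a ^ (3 : ℕ) -
          u 1 ^ (2 : ℕ) * u 2 ^ (4 : ℕ) * M * a ^ (3 : ℕ) -
          2 * u 1 ^ (3 : ℕ) * u 2 ^ (4 : ℕ) * a ^ (3 : ℕ) + u 2 ^ (2 : ℕ) * M * a ^ (5 : ℕ) -
          2 * u 1 * u 2 ^ (2 : ℕ) * M ^ (2 : ℕ) * a ^ (3 : ℕ) +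
          2 * u 1 ^ (2 : ℕ) * u 2 ^ (2 : ℕ) * M * a ^ (3 : ℕ) +
          2 * u 1 ^ (3 : ℕ) * u 2 ^ (2 : ℕ) * a ^ (3 : ℕ) -
          2 * u 1 ^ (3 : ℕ) * u 2 ^ (2 : ℕ) * M ^ (2 : ℕ) * a -
          u 1 ^ (5 : ℕ) * u 2 ^ (2 : ℕ) * a - u 1 ^ (2 : ℕ) * M * a ^ (3 : ℕ) +
          2 * u 1 ^ (3 : ℕ) * M ^ (2 : ℕ) * a + u 1 ^ (5 : ℕ) * a) / sigma a u ^ (3 : ℕ),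
        (u 2 ^ (7 : ℕ) * a ^ (5 : ℕ) - u 2 ^ (5 : ℕ) * a ^ (5 : ℕ) +
          2 * u 1 ^ (2 : ℕ) * u 2 ^ (5 : ℕ) * a ^ (3 : ℕ) +
          2 * u 1 * u 2 ^ (3 : ℕ) * M * a ^ (3 : ℕ) -
          2 * u 1 ^ (2 : ℕ) * u 2 ^ (3 : ℕ) * a ^ (3 : ℕ) +
          2 * u 1 ^ (3 : ℕ) * u 2 ^ (3 : ℕ) * M * a + u 1 ^ (4 : ℕ) * u 2 ^ (3 : ℕ) * a -
          2 * u 1 * u 2 * M * a ^ (3 : ℕ) - 2 * u 1 ^ (3 : ℕ) * u 2 * M * a -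
          u 1 ^ (4 : ℕ) * u 2 * a) / sigma a u ^ (3 : ℕ),
        (-(u 2 ^ (4 : ℕ) * M * a ^ (4 : ℕ)) + u 1 * u 2 ^ (4 : ℕ) * a ^ (4 : ℕ) +
          u 2 ^ (2 : ℕ) * M * a ^ (4 : ℕ) + u 1 ^ (2 : ℕ) * u 2 ^ (2 : ℕ) * M * a ^ (2 : ℕ) +
          2 * u 1 ^ (3 : ℕ) * u 2 ^ (2 : ℕ) * a ^ (2 : ℕ) - u 1 ^ (2 : ℕ) * M * a ^ (2 : ℕ) +
          u 1 ^ (5 : ℕ)) / sigma a u ^ (3 : ℕ)] := by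
  refine chrAt_eq_of_forall M a hu fun w ↦ ?_
  have hS := hu.1
  have hP := hu.2
  rw [map_smul, _root_.smul_apply, koszulCLM_eq_koszulForm, koszulForm_bilin M a hu, bilin_apply]
  simp only [bilinR_apply, bilinM_apply, bv_apply, Fin.isValue, Fin.reduceEq, if_true, if_false,
    Matrix.cons_val_zero, Matrix.cons_val_one, Matrix.cons_val, smul_eq_mul, mul_one, one_mul,
    mul_zero, zero_mul, add_zero, zero_add]
  simp only [h00, h03, c13, c22, c33, c33r, h00r, h00m, h03r, h03m, scalarH, scalarHr, scalarHm]
  field_simp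
  simp only [sigma, sinSq]
  ring

/-- **`Γ(∂_2, ∂_2)`** of the Kerr components in ingoing Kerr coordinates (closed form, a vector of
`E4`; O'Neill 1983, Ch. 3, Prop. 3.13). [cite: KerrSchild1965, §3] -/
theorem chrAt_bv_22 (hu : u ∈ regularSet a) :
    chrAt (bilin M a) u (E4.basisVector 2) (E4.basisVector 2) =
      !₂[(-(2 * u 1 ^ (2 : ℕ) * M)) / (sigma a u * sinSq u),
        (-(u 1 * a ^ (2 : ℕ)) + 2 * u 1 ^ (2 : ℕ) * M - u 1 ^ (3 : ℕ)) / (sigma a u * sinSq u),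
        (u 2 * a ^ (2 : ℕ) + u 1 ^ (2 : ℕ) * u 2) / (sigma a u * sinSq u),
        (-(u 1 * a)) / (sigma a u * sinSq u)] := by
  refine chrAt_eq_of_forall M a hu fun w ↦ ?_
  have hS := hu.1
  have hP := hu.2
  rw [map_smul, _root_.smul_apply, koszulCLM_eq_koszulForm, koszulForm_bilin M a hu, bilin_apply]
  simp only [bilinR_apply, bilinM_apply, bv_apply, Fin.isValue, Fin.reduceEq, if_true, if_false,
    Matrix.cons_val_zero, Matrix.cons_val_one, Matrix.cons_val, smul_eq_mul, mul_one, one_mul,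
    mul_zero, zero_mul, add_zero, zero_add]
  simp only [h00, h03, c13, c22, c33, c22r, c22m, scalarH]
  field_simp
  simp only [sigma, sinSq]
  ring

/-- **`Γ(∂_2, ∂_3)`** of the Kerr components in ingoing Kerr coordinates (closed form, a vector of
`E4`; O'Neill 1983, Ch. 3, Prop. 3.13). [cite: KerrSchild1965, §3] -/
theorem chrAt_bv_23 (hu : u ∈ regularSet a) :
    chrAt (bilin M a) u (E4.basisVector 2) (E4.basisVector 3) =
      !₂[(2 * u 1 * u 2 ^ (3 : ℕ) * M * a ^ (3 : ℕ) -
          2 * u 1 * u 2 * M * a ^ (3 : ℕ)) / sigma a u ^ (2 : ℕ),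
        0,
        0,
        (-(u 2 ^ (5 : ℕ) * a ^ (4 : ℕ)) + 2 * u 1 * u 2 ^ (3 : ℕ) * M * a ^ (2 : ℕ) -
          2 * u 1 ^ (2 : ℕ) * u 2 ^ (3 : ℕ) * a ^ (2 : ℕ) - 2 * u 1 * u 2 * M * a ^ (2 : ℕ) -
          u 1 ^ (4 : ℕ) * u 2) / (sigma a u ^ (2 : ℕ) * sinSq u)] := by
  refine chrAt_eq_of_forall M a hu fun w ↦ ?_
  have hS := hu.1
  have hP := hu.2
  rw [map_smul, _root_.smul_apply, koszulCLM_eq_koszulForm, koszulForm_bilin M a hu, bilin_apply]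
  simp only [bilinR_apply, bilinM_apply, bv_apply, Fin.isValue, Fin.reduceEq, if_true, if_false,
    Matrix.cons_val_zero, Matrix.cons_val_one, Matrix.cons_val, smul_eq_mul, mul_one, one_mul,
    mul_zero, zero_mul, add_zero, zero_add, sub_zero]
  simp only [h00, h03, c13, c33, c33m, h00m, h03m, scalarH, scalarHm]
  field_simp
  simp only [sigma, sinSq]
  ring

/-- **`Γ(∂_3, ∂_3)`** of the Kerr components in ingoing Kerr coordinates (closed form, a vector of
`E4`; O'Neill 1983, Ch. 3, Prop. 3.13). [cite: KerrSchild1965, §3] -/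
theorem chrAt_bv_33 (hu : u ∈ regularSet a) :
    chrAt (bilin M a) u (E4.basisVector 3) (E4.basisVector 3) =
      !₂[(-(2 * u 1 * u 2 ^ (6 : ℕ) * M ^ (2 : ℕ) * a ^ (4 : ℕ)) +
          2 * u 1 ^ (2 : ℕ) * u 2 ^ (6 : ℕ) * M * a ^ (4 : ℕ) +
          4 * u 1 * u 2 ^ (4 : ℕ) * M ^ (2 : ℕ) * a ^ (4 : ℕ) -
          2 * u 1 ^ (2 : ℕ) * u 2 ^ (4 : ℕ) * M * a ^ (4 : ℕ) +
          2 * u 1 ^ (3 : ℕ) * u 2 ^ (4 : ℕ) * M ^ (2 : ℕ) * a ^ (2 : ℕ) +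
          4 * u 1 ^ (4 : ℕ) * u 2 ^ (4 : ℕ) * M * a ^ (2 : ℕ) -
          2 * u 1 * u 2 ^ (2 : ℕ) * M ^ (2 : ℕ) * a ^ (4 : ℕ) -
          4 * u 1 ^ (3 : ℕ) * u 2 ^ (2 : ℕ) * M ^ (2 : ℕ) * a ^ (2 : ℕ) -
          4 * u 1 ^ (4 : ℕ) * u 2 ^ (2 : ℕ) * M * a ^ (2 : ℕ) +
          2 * u 1 ^ (6 : ℕ) * u 2 ^ (2 : ℕ) * M + 2 * u 1 ^ (3 : ℕ) * M ^ (2 : ℕ) * a ^ (2 : ℕ) -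
          2 * u 1 ^ (6 : ℕ) * M) / sigma a u ^ (3 : ℕ),
        (-(u 2 ^ (6 : ℕ) * M * a ^ (6 : ℕ)) + u 1 * u 2 ^ (6 : ℕ) * a ^ (6 : ℕ) +
          2 * u 1 * u 2 ^ (6 : ℕ) * M ^ (2 : ℕ) * a ^ (4 : ℕ) -
          3 * u 1 ^ (2 : ℕ) * u 2 ^ (6 : ℕ) * M * a ^ (4 : ℕ) +
          u 1 ^ (3 : ℕ) * u 2 ^ (6 : ℕ) * a ^ (4 : ℕ) + 2 * u 2 ^ (4 : ℕ) * M * a ^ (6 : ℕ) -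
          u 1 * u 2 ^ (4 : ℕ) * a ^ (6 : ℕ) -
          4 * u 1 * u 2 ^ (4 : ℕ) * M ^ (2 : ℕ) * a ^ (4 : ℕ) +
          5 * u 1 ^ (2 : ℕ) * u 2 ^ (4 : ℕ) * M * a ^ (4 : ℕ) +
          u 1 ^ (3 : ℕ) * u 2 ^ (4 : ℕ) * a ^ (4 : ℕ) -
          2 * u 1 ^ (3 : ℕ) * u 2 ^ (4 : ℕ) * M ^ (2 : ℕ) * a ^ (2 : ℕ) -
          3 * u 1 ^ (4 : ℕ) * u 2 ^ (4 : ℕ) * M * a ^ (2 : ℕ) +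
          2 * u 1 ^ (5 : ℕ) * u 2 ^ (4 : ℕ) * a ^ (2 : ℕ) - u 2 ^ (2 : ℕ) * M * a ^ (6 : ℕ) +
          2 * u 1 * u 2 ^ (2 : ℕ) * M ^ (2 : ℕ) * a ^ (4 : ℕ) -
          3 * u 1 ^ (2 : ℕ) * u 2 ^ (2 : ℕ) * M * a ^ (4 : ℕ) -
          2 * u 1 ^ (3 : ℕ) * u 2 ^ (2 : ℕ) * a ^ (4 : ℕ) +
          4 * u 1 ^ (3 : ℕ) * u 2 ^ (2 : ℕ) * M ^ (2 : ℕ) * a ^ (2 : ℕ) +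
          2 * u 1 ^ (4 : ℕ) * u 2 ^ (2 : ℕ) * M * a ^ (2 : ℕ) -
          u 1 ^ (5 : ℕ) * u 2 ^ (2 : ℕ) * a ^ (2 : ℕ) - 2 * u 1 ^ (6 : ℕ) * u 2 ^ (2 : ℕ) * M +
          u 1 ^ (7 : ℕ) * u 2 ^ (2 : ℕ) + u 1 ^ (2 : ℕ) * M * a ^ (4 : ℕ) -
          2 * u 1 ^ (3 : ℕ) * M ^ (2 : ℕ) * a ^ (2 : ℕ) + u 1 ^ (4 : ℕ) * M * a ^ (2 : ℕ) -
          u 1 ^ (5 : ℕ) * a ^ (2 : ℕ) + 2 * u 1 ^ (6 : ℕ) * M -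
          u 1 ^ (7 : ℕ)) / sigma a u ^ (3 : ℕ),
        (-(u 2 ^ (7 : ℕ) * a ^ (6 : ℕ)) + 2 * u 1 * u 2 ^ (7 : ℕ) * M * a ^ (4 : ℕ) -
          u 1 ^ (2 : ℕ) * u 2 ^ (7 : ℕ) * a ^ (4 : ℕ) + u 2 ^ (5 : ℕ) * a ^ (6 : ℕ) -
          2 * u 1 * u 2 ^ (5 : ℕ) * M * a ^ (4 : ℕ) -
          u 1 ^ (2 : ℕ) * u 2 ^ (5 : ℕ) * a ^ (4 : ℕ) +
          4 * u 1 ^ (3 : ℕ) * u 2 ^ (5 : ℕ) * M * a ^ (2 : ℕ) -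
          2 * u 1 ^ (4 : ℕ) * u 2 ^ (5 : ℕ) * a ^ (2 : ℕ) -
          2 * u 1 * u 2 ^ (3 : ℕ) * M * a ^ (4 : ℕ) +
          2 * u 1 ^ (2 : ℕ) * u 2 ^ (3 : ℕ) * a ^ (4 : ℕ) -
          8 * u 1 ^ (3 : ℕ) * u 2 ^ (3 : ℕ) * M * a ^ (2 : ℕ) +
          u 1 ^ (4 : ℕ) * u 2 ^ (3 : ℕ) * a ^ (2 : ℕ) - u 1 ^ (6 : ℕ) * u 2 ^ (3 : ℕ) +
          2 * u 1 * u 2 * M * a ^ (4 : ℕ) + 4 * u 1 ^ (3 : ℕ) * u 2 * M * a ^ (2 : ℕ) +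
          u 1 ^ (4 : ℕ) * u 2 * a ^ (2 : ℕ) + u 1 ^ (6 : ℕ) * u 2) / sigma a u ^ (3 : ℕ),
        (-(u 2 ^ (6 : ℕ) * M * a ^ (5 : ℕ)) + u 1 * u 2 ^ (6 : ℕ) * a ^ (5 : ℕ) +
          2 * u 2 ^ (4 : ℕ) * M * a ^ (5 : ℕ) - u 1 * u 2 ^ (4 : ℕ) * a ^ (5 : ℕ) +
          u 1 ^ (2 : ℕ) * u 2 ^ (4 : ℕ) * M * a ^ (3 : ℕ) +
          2 * u 1 ^ (3 : ℕ) * u 2 ^ (4 : ℕ) * a ^ (3 : ℕ) - u 2 ^ (2 : ℕ) * M * a ^ (5 : ℕ) -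
          2 * u 1 ^ (2 : ℕ) * u 2 ^ (2 : ℕ) * M * a ^ (3 : ℕ) -
          2 * u 1 ^ (3 : ℕ) * u 2 ^ (2 : ℕ) * a ^ (3 : ℕ) + u 1 ^ (5 : ℕ) * u 2 ^ (2 : ℕ) * a +
          u 1 ^ (2 : ℕ) * M * a ^ (3 : ℕ) - u 1 ^ (5 : ℕ) * a) / sigma a u ^ (3 : ℕ)] := by
  refine chrAt_eq_of_forall M a hu fun w ↦ ?_
  have hS := hu.1
  have hP := hu.2
  rw [map_smul, _root_.smul_apply, koszulCLM_eq_koszulForm, koszulForm_bilin M a hu, bilin_apply]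
  simp only [bilinR_apply, bilinM_apply, bv_apply, Fin.isValue, Fin.reduceEq, if_true, if_false,
    Matrix.cons_val_zero, Matrix.cons_val_one, Matrix.cons_val, smul_eq_mul, mul_one, one_mul,
    mul_zero, zero_mul, add_zero, zero_add, zero_sub]
  simp only [h00, h03, c13, c22, c33, c33r, c33m, h00r, h00m, scalarH, scalarHr, scalarHm]
  field_simp
  simp only [sigma, sinSq]
  ring

end Ingoing

end Kerr

end Literature.Geometry.Lorentzian

end
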